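import Mathlib
import Summits.NavierStokesRegularity.NavierStokesRegularity.Theorems.WakeRatchetTailRatchet.Negative.TailRatchetFalseOfDyadicPersistentFrames
import Summits.NavierStokesRegularity.NavierStokesRegularity.Theorems.WakeRatchetTailRatchetPostFiringAction
import Summits.NavierStokesRegularity.NavierStokesRegularity.Theorems.WakeRatchetTailRatchetPostFiringCauchy
import HarnessLib
import HarnessLib.Audit

/-!
# `WakeRatchet.TailRatchet` (stmt-NavierStokesRegularity-21808) — door D4′ reduced to ONE a-priori estimate on ONE
# object: the post-firing bound (D) for the one-shell non-negative dyadic Cauchy blow-up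

The tree refutes the crux modulo `WakeRatchetDyadicScalarEternal.DyadicPersistentFrames` (frames of the
renormalised dyadic lattice with a uniform bound, a WINDOW-MASS bound (W), FORWARD-ENERGY bounds (E) and FIRING IN
WINDOWS (G), at arbitrarily small `ε₀`; `TailRatchet_false_of_DyadicPersistentFrames`).  This file closes the
bookkeeping of door D4′ down to a single inequality about a single explicit solution:

* `persistentFrames_of_postFiringDecay` — a quiet-start, bounded, non-negative half-line solution of the
  renormalised lattice with a lower rate at level `c` (`Λc < 1`) and POST-FIRING DECAY (D′) yields frames
  `V j n σ = W (n+j) (σ + s j)` (recentred at the first firings `s j`, tree `WakeRatchetTailRatchetPostFiringClock`)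
  with (W) (`WakeRatchetTailRatchetPostFiringAction.windowMass_le`), (E) ((D′) + the gap bound), (G) (the gap
  bound) — the body of `DyadicPersistentFrames`;
* `DyadicCauchyPostFiringBound` (THE CONSTRUCTION ITEM): at arbitrarily small `ε₀`, every solution bundle of the
  shape delivered by `WakeRatchetDyadicCauchy.dyadic_blowup_typeI` for the one-shell datum `X⁰ = 1_{n=0}` (there is
  exactly one by `dyadic_unique`; it EXISTS by `dyadic_blowup_typeI`) obeys the census's post-firing bound (D):
  `ΛⁿX_n(t₁)(T*−t₁) ≥ 1/(2(Λ+Λ⁻¹))`, `0 ≤ t₁ ≤ t₂ < T*` ⟹ `ΛⁿX_n(t₂) ≤ D/(T*−t₁)`;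
* `dyadicPersistentFrames_of_cauchyPostFiringBound` — (D) ⟹ `DyadicPersistentFrames` (the tree's blow-up theorem
  supplies the bundle, `WakeRatchetTailRatchetPostFiringCauchy.postFiringDecay_body_of_cauchy` the hypotheses of the
  reduction), and `TailRatchet_false_of_DyadicCauchyPostFiringBound` — (D) ⟹ `¬ TailRatchet`.

So door D4′ = ONE estimate: (D) for the one-shell dyadic blow-up at fixed `Λ = (1+ε₀)^{5/2}` close to `1`
(asymptotic tightness of the blow-up front in log-time; Katz–Pavlović 2005 / Kiselev–Zlatoš 2005 /
Cheskidov–Friedlander–Pavlović 2010 give blow-up, not this; numerically the front is DSS, evidence on the item).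

HONEST FRAMING: MODEL lattice ODEs (Tao 2016 §1.2, §4, §6.4); nothing here concerns the Navier–Stokes equations;
nothing is settled unconditionally; the item stays open (negative lemma modulo a construction).
-/

noncomputable section

set_option linter.dupNamespace false

namespace Summit.NavierStokesRegularity.NavierStokesRegularity.Theorems

namespace WakeRatchetDyadicPostFiring

open Set Filter Topology MeasureTheory intervalIntegral
open Literature.Analysis.FluidPDE Literature.Analysis.FluidPDE.TaoCascade
open WakeRatchetFiringClock WakeRatchetDyadicScalarEternal

variable {W : ℤ → ℝ → ℝ} {A₀ A B c D : ℝ}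

/-! ## The recentred frames inhabit `DyadicPersistentFrames` -/

/-- **THE REDUCTION.**  A quiet-start, bounded, non-negative half-line solution of the renormalised dyadic lattice
at `Λ = bigLam ε₀` with a lower rate at level `c` (`Λc < 1`) and POST-FIRING DECAY (D′) yields frames
`V j n σ = W (n+j) (σ + s j)` (recentred at the first firings) with all the properties of the body of
`DyadicPersistentFrames` at this `ε₀`: law, uniform bound, window mass, forward energy, firing in windows.
[cite: Tao2016AveragedNS, §1.2, §4 Lemma 4.1 (4.8), §6.4; cell vocabulary (door D4′ of stmt-21808)] -/
theorem persistentFrames_of_postFiringDecay {ε₀ : ℝ} (hε₀ : 0 < ε₀) (hA : A₀ < A) (hc : 0 < c)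
    (hΛc : bigLam ε₀ * c < 1)
    (hlaw : ∀ (n : ℤ) (σ : ℝ), A₀ < σ → HasDerivAt (W n)
      (-(W n σ) + bigLam ε₀ * W (n - 1) σ ^ 2 - (bigLam ε₀)⁻¹ * W n σ * W (n + 1) σ) σ)
    (hnn : ∀ (n : ℤ) (σ : ℝ), A ≤ σ → 0 ≤ W n σ) (hB : ∀ (n : ℤ) (σ : ℝ), A ≤ σ → W n σ ≤ B)
    (hneg : ∀ n : ℤ, n < 0 → ∀ σ : ℝ, A ≤ σ → W n σ = 0) (hstart : ∀ n : ℤ, 0 < n → W n A = 0)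
    (hrate : ∀ σ : ℝ, A ≤ σ → ∃ n : ℤ, c ≤ W n σ)
    (hdec : ∀ (n : ℤ) (σ₁ σ₂ : ℝ), A ≤ σ₁ → σ₁ ≤ σ₂ → c ≤ W n σ₁ →
      W n σ₂ ≤ D * Real.exp (-(σ₂ - σ₁))) :
    ∃ (V : ℕ → ℤ → ℝ → ℝ) (Af : ℕ → ℝ) (B' M : ℝ),
      Tendsto Af atTop atBot ∧
      (∀ (j : ℕ) (n : ℤ) (σ : ℝ), Af j < σ → HasDerivAt (V j n)
        (-(V j n σ) + bigLam ε₀ * V j (n - 1) σ ^ 2 - (bigLam ε₀)⁻¹ * V j n σ * V j (n + 1) σ) σ) ∧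
      (∀ (j : ℕ) (n : ℤ) (σ : ℝ), Af j < σ → |V j n σ| ≤ B') ∧
      (∀ (j : ℕ) (n : ℤ) (a b : ℝ), Af j < a → a ≤ b → ∫ u in a..b, |V j n u| ≤ M) ∧
      (∀ n : ℤ, ∃ σ₁ P : ℝ, ∀ (j : ℕ) (σ : ℝ), σ₁ ≤ σ → Af j < σ →
        Real.exp (2 * σ) * V j n σ ^ 2 ≤ P) ∧
      (∃ c' : ℝ, 0 < c' ∧ ∃ (n₀ : ℤ) (σ₀ : ℝ) (g : ℕ → ℝ), ∀ k : ℕ, ∀ᶠ j in atTop,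
        ∃ τ : ℝ, σ₀ ≤ τ ∧ τ ≤ σ₀ + g k ∧ c' ≤ |V j (n₀ + k) τ|) := by
  have hΛ : 0 < bigLam ε₀ := bigLam_pos (by linarith)
  have hcD : c ≤ D := level_le_D hc hneg hstart hrate hdec
  have hD0 : 0 ≤ D := hc.le.trans hcD
  obtain ⟨s, hs1, hs2, hs3⟩ := exists_firstFiring hΛ hA hc hΛc.le hlaw hnn hneg hstart hrate hdec
  have hmono : Monotone s := firstFiring_mono hΛ hA hc hΛc.le hlaw hnn hstart hs1 hs2 hs3
  have hgap := firstFiring_gap_le hc hcD hneg hrate hdec hs1 hs2 hs3 hmono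
  have hinf := firstFiring_tendsto_atTop hc hcD hneg hrate hdec hs1 hs2 hmono
  set L : ℝ := Real.log (D / c) with hL
  have hL0 : 0 ≤ L := Real.log_nonneg ((one_le_div hc).2 hcD)
  set M : ℝ := bigLam ε₀ * (D ^ 2 / 2) / (1 - bigLam ε₀ * c) + D with hM
  refine ⟨fun j n σ => W (n + j) (σ + s j), fun j => A - s j, B, M, ?_, ?_, ?_, ?_, ?_, ?_⟩
  · -- `A - s j → -∞`
    refine tendsto_atBot.2 fun b => ?_
    filter_upwards [tendsto_atTop.1 hinf (A - b)] with j hj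
    linarith
  · -- the law (translation invariance)
    intro j n σ hσ
    have h := hlaw (n + j) (σ + s j) (by linarith)
    have h' := h.comp_add_const σ (s j)
    have e1 : n + (j : ℤ) - 1 = n - 1 + j := by ring
    have e2 : n + (j : ℤ) + 1 = n + 1 + j := by ring
    rw [e1, e2] at h'
    exact h'
  · -- uniform bound
    intro j n σ hσ
    have hσ' : A ≤ σ + s j := by linarith
    show |W (n + j) (σ + s j)| ≤ B
    rw [abs_of_nonneg (hnn (n + j) _ hσ')]
    exact hB (n + j) _ hσ'
  · -- window mass (W)
    intro j n a b ha hab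
    have h := windowMass_le hΛ hA hc hΛc hlaw hnn hneg hstart hrate hdec hs1 hs2 hs3 hmono (n + j)
      (a := a + s j) (b := b + s j) (by linarith) (by linarith)
    show (∫ u in a..b, |W (n + j) (u + s j)|) ≤ M
    rw [intervalIntegral.integral_comp_add_right (fun u => |W (n + j) u|) (s j)]
    exact h
  · -- forward energy (E)
    intro n
    refine ⟨(n.toNat : ℝ) * L, D ^ 2 * Real.exp (2 * ((n.toNat : ℝ) * L)), fun j σ hσ₁ hσA => ?_⟩
    have hσ' : A ≤ σ + s j := by linarith
    show Real.exp (2 * σ) * W (n + j) (σ + s j) ^ 2 ≤ D ^ 2 * Real.exp (2 * ((n.toNat : ℝ) * L))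
    rcases lt_or_ge (n + (j : ℤ)) 0 with hm | hm
    · rw [hneg _ hm _ hσ']
      simp only [ne_eq, OfNat.ofNat_ne_zero, not_false_eq_true, zero_pow, mul_zero]
      positivity
    · obtain ⟨k, hk⟩ : ∃ k : ℕ, (k : ℤ) = n + j := ⟨(n + j).toNat, Int.toNat_of_nonneg hm⟩
      rw [← hk]
      have hkj : k ≤ j + n.toNat := by omega
      have hsk : s k ≤ s j + (n.toNat : ℝ) * L := (hmono hkj).trans (hgap j n.toNat)
      have hle : s k ≤ σ + s j := by linarith
      have hd := decay_from_firstFiring hdec hs1 hs2 k hle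
      have h0 : 0 ≤ W (k : ℤ) (σ + s j) := hnn _ _ hσ'
      have hexp : Real.exp (2 * σ) * (D * Real.exp (-(σ + s j - s k))) ^ 2
          = D ^ 2 * Real.exp (2 * (s k - s j)) := by
        have e2 : Real.exp (-(σ + s j - s k)) ^ 2 = Real.exp (2 * (-(σ + s j - s k))) := by
          rw [← Real.exp_nat_mul]; norm_num
        rw [mul_pow, e2, mul_left_comm, ← Real.exp_add]
        congr 1
        congr 1
        ring
      calc Real.exp (2 * σ) * W (k : ℤ) (σ + s j) ^ 2
          ≤ Real.exp (2 * σ) * (D * Real.exp (-(σ + s j - s k))) ^ 2 := by gcongr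
        _ = D ^ 2 * Real.exp (2 * (s k - s j)) := hexp
        _ ≤ D ^ 2 * Real.exp (2 * ((n.toNat : ℝ) * L)) := by gcongr; linarith
  · -- firing in windows (G)
    refine ⟨c, hc, 0, 0, fun k => k * L, fun k => Eventually.of_forall fun j => ⟨s (j + k) - s j, ?_, ?_, ?_⟩⟩
    · linarith [hmono (Nat.le_add_right j k)]
    · have := hgap j k; linarith
    · show c ≤ |W (0 + (k : ℤ) + j) (s (j + k) - s j + s j)|
      have e1 : (0 : ℤ) + (k : ℤ) + (j : ℤ) = ((j + k : ℕ) : ℤ) := by push_cast; ring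
      rw [e1, sub_add_cancel]
      exact (hs2 (j + k)).trans (le_abs_self _)

/-! ## The construction item and the negative lemma -/

/-- **The construction (door D4′ as ONE estimate on ONE object): the post-firing bound (D) for the one-shell
non-negative dyadic Cauchy blow-up at arbitrarily small scale ratios.**  For every `ε > 0` there is
`ε₀ ∈ (0, ε]` (`Λ = bigLam ε₀ = (1+ε₀)^{5/2}`, `δ₀ = 1/((Λ+Λ⁻¹)·2² + 1)`) such that every `(T*, X)` of the shape
delivered by `WakeRatchetDyadicCauchy.dyadic_blowup_typeI` for the datum `X⁰_n = 1_{n=0}` — `X` solves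
`Ẋₙ = Λⁿ⁻¹Xₙ₋₁² − ΛⁿXₙXₙ₊₁` on `(−δ₀, T*)` through `X⁰`, is regular below `T*`, non-negative on `[0,T*)`, obeys the
type-I frame bound `ΛⁿXₙ(t)(T*−t) ≤ 2Λ²/(Λ−1)²` and the lower rate `1 ≤ (Λ+Λ⁻¹)β(T*−t)` for every frame bound `β`
— obeys, for some `D`, the POST-FIRING BOUND (D): whenever shell `n` has reached the renormalised level
`ΛⁿXₙ(t₁)(T*−t₁) ≥ 1/(2(Λ+Λ⁻¹))` at `t₁ ∈ [0,T*)`, then `ΛⁿXₙ(t₂) ≤ D/(T* − t₁)` for all `t₂ ∈ [t₁, T*)`.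
(Such a pair EXISTS for every `ε₀ > 0` by `dyadic_blowup_typeI` and is unique by `dyadic_unique`; (D) says the
blow-up front is uniformly tight in log-time: a shell that has fired is `O(1)` log-time later in its
`e^{−σ}`-wake.  Not in print; numerically true (the one-shell cascade converges to a DSS front).)
[cite: Tao2016AveragedNS, §1.2 (dyadic model: finite time blow-up), §4 Lemma 4.1 (4.8) with `m = 1`, §6.4; cell vocabulary (construction item of door D4′ for stmt-21808)] -/
@[conjecture] def DyadicCauchyPostFiringBound : Prop :=
  ∀ ε : ℝ, 0 < ε → ∃ ε₀ : ℝ, 0 < ε₀ ∧ ε₀ ≤ ε ∧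
    ∀ (Tstar : ℝ) (X : ℤ → ℝ → ℝ), 0 < Tstar →
      (∀ n : ℤ, X n 0 = if n = 0 then 1 else 0) →
      (∀ n : ℤ, ∀ t ∈ Ioo (-(1 / ((bigLam ε₀ + (bigLam ε₀)⁻¹) * (1 + 1) ^ 2 + 1))) Tstar,
        HasDerivAt (X n) (bigLam ε₀ ^ (n - 1) * X (n - 1) t ^ 2 - bigLam ε₀ ^ n * X n t * X (n + 1) t) t) →
      (∀ T', T' < Tstar → ∃ B : ℝ, ∀ n : ℤ,
        ∀ t ∈ Ioo (-(1 / ((bigLam ε₀ + (bigLam ε₀)⁻¹) * (1 + 1) ^ 2 + 1))) T', |bigLam ε₀ ^ n * X n t| ≤ B) →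
      (∀ n : ℤ, ∀ t ∈ Ico 0 Tstar, 0 ≤ X n t) →
      (∀ n : ℤ, ∀ t ∈ Ico 0 Tstar, bigLam ε₀ ^ n * X n t * (Tstar - t) ≤ 2 * bigLam ε₀ ^ 2 / (bigLam ε₀ - 1) ^ 2) →
      (∀ t ∈ Ioo (-(1 / ((bigLam ε₀ + (bigLam ε₀)⁻¹) * (1 + 1) ^ 2 + 1))) Tstar, ∀ β : ℝ, 0 < β →
        (∀ n : ℤ, |bigLam ε₀ ^ n * X n t| ≤ β) → 1 ≤ (bigLam ε₀ + (bigLam ε₀)⁻¹) * β * (Tstar - t)) →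
      ∃ D : ℝ, ∀ (n : ℤ) (t₁ t₂ : ℝ), 0 ≤ t₁ → t₁ ≤ t₂ → t₂ < Tstar →
        1 / (2 * (bigLam ε₀ + (bigLam ε₀)⁻¹)) ≤ bigLam ε₀ ^ n * X n t₁ * (Tstar - t₁) →
          bigLam ε₀ ^ n * X n t₂ ≤ D / (Tstar - t₁)

/-- **(D) ⟹ `DyadicPersistentFrames`.**  The tree's blow-up theorem supplies the one-shell solution bundle at every
`ε₀`; (D) and `postFiringDecay_body_of_cauchy` supply the hypotheses of `persistentFrames_of_postFiringDecay`.
[cite: Tao2016AveragedNS, §1.2, §4 Lemma 4.1 (4.8), §6.4; cell vocabulary] -/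
theorem dyadicPersistentFrames_of_cauchyPostFiringBound :
    DyadicCauchyPostFiringBound → DyadicPersistentFrames := by
  intro h ε hε
  obtain ⟨ε₀, hε₀, hle, H⟩ := h ε hε
  have hΛ1 : 1 < bigLam ε₀ := by unfold bigLam; exact Real.one_lt_rpow (by linarith) (by norm_num)
  have hΛ0 : 0 < bigLam ε₀ := by linarith
  -- the one-shell datum
  have hX₀ : ∀ n : ℤ, |bigLam ε₀ ^ n * (if n = 0 then (1 : ℝ) else 0)| ≤ 1 := by
    intro n
    split_ifs with hn
    · subst hn; simp
    · simp
  have hpos : ∀ n : ℤ, 0 ≤ (if n = 0 then (1 : ℝ) else 0) := fun n => by split_ifs <;> norm_num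
  have hM : 0 < (if (0 : ℤ) = 0 then (1 : ℝ) else 0) := by simp
  obtain ⟨Tstar, hδT, -, X, h0, hlaw, hreg, hnn, htypeI, hlow⟩ :=
    WakeRatchetDyadicCauchy.dyadic_blowup_typeI hΛ1 zero_le_one hX₀ hpos hM
  have hδ₀ : 0 < 1 / ((bigLam ε₀ + (bigLam ε₀)⁻¹) * (1 + 1) ^ 2 + 1) := by
    have : 0 < (bigLam ε₀)⁻¹ := inv_pos.2 hΛ0
    positivity
  have hT : 0 < Tstar := hδ₀.trans_le hδT
  obtain ⟨D, hD⟩ := H Tstar X hT h0 hlaw hreg hnn htypeI hlow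
  have hdata : ∀ n : ℤ, n ≠ 0 → X n 0 = 0 := fun n hn => by rw [h0 n, if_neg hn]
  obtain ⟨W, A₀, A, B, c, D', hA, hc, hΛc, hlaw', hbd, hneg, hstart, hrate, hdec⟩ :=
    postFiringDecay_body_of_cauchy hε₀ hδ₀ hT hdata hlaw hreg hnn htypeI hlow hD
  obtain ⟨V, Af, B', M, h1, h2, h3, h4, h5, h6⟩ := persistentFrames_of_postFiringDecay hε₀ hA hc hΛc hlaw'
    (fun n σ hσ => (hbd n σ hσ).1) (fun n σ hσ => (hbd n σ hσ).2) hneg hstart hrate hdec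
  exact ⟨ε₀, hε₀, hle, V, Af, B', M, h1, h2, h3, h4, h5, h6⟩

/-- **Negative lemma (door D4′ as one estimate): `DyadicCauchyPostFiringBound → ¬ TailRatchet`.**
[cite: Tao2016AveragedNS, §1.2, §4 Lemma 4.1 (4.8), §6.4; cell vocabulary] -/
theorem TailRatchet_false_of_DyadicCauchyPostFiringBound :
    DyadicCauchyPostFiringBound →
      ¬ Summit.NavierStokesRegularity.NavierStokesRegularity.Theses.WakeRatchet.TailRatchet :=
  fun h => TailRatchet_false_of_DyadicPersistentFrames (dyadicPersistentFrames_of_cauchyPostFiringBound h)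

end WakeRatchetDyadicPostFiring

end Summit.NavierStokesRegularity.NavierStokesRegularity.Theorems

end
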